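import Summits.ValiantsHypothesis.ValiantsHypothesis.Theorems.KPlusLogSqLawStaticPathChain

/-!
# Route «KPlusLogSqLaw» — parametric max-weight independent set on a path: SLOPES INCREASE along every chain of unique optima

HONEST FRAMING.  Helper toward the crux `WeakLifting` (item `stmt-ValiantsHypothesis-19561`, route `KPlusLogSqLaw`, cell `pub-symmetroid`,
seat val-sym-lift-p4 g8, 2026-08-27) on the line of its witness-plan stub `stub_tridiagonalSectorB` (tropical twin of the STATIC tridiagonal
sector = parametric maximum-weight independent set on a path = Eppstein's parametric closure problem on the fence, arXiv:1504.04073).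
The CONVEXITY mechanism, complementary to the record calculus: the optimum `θ ↦ opt θ` is a maximum of lines, so along any chain of unique
optima at increasing parameters the SLOPE `Σ_{t ∈ M} w₁ t` strictly increases (`slope_lt_of_unique`, `chain_slopes_strictMono`) — no genericity
needed.  Corollaries: with a UNIFORM slope `w₁ t = c` («uniform field sweep») a chain has at most `⌈n/2⌉` steps, since the sizes `|M_k| ≤ ⌈n/2⌉`
(`card_le_of_mem_indepSets`) are then strictly monotone (`chain_le_half_of_uniform_slope`); with INTEGER slopes of absolute value `≤ V` a chain has
at most `2·⌈n/2⌉·V` steps (`chain_le_of_int_slopes`).  So superlinear growth of the static path sector's tropical count, if any, needs slopes in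
general position (cf. `chain_le_choose`, `chain_le`: the general ceilings).  Statements about a path DP; nothing here asserts anything about
`WeakLifting`, `TropicalB`, `KPlusLogSqLaw`, the stub in its window, `MatrixDescartes` (stmt-ValiantsHypothesis-18050) or `VP ≠ VNP`.
-/

set_option linter.dupNamespace false
set_option autoImplicit false

namespace Summit.ValiantsHypothesis.ValiantsHypothesis.Theorems.KPlusLogSqLaw

open Finset Classical

namespace StaticPathFold

noncomputable section

variable (w₁ w₀ : ℕ → ℝ)

/-- **independent subsets of `n` consecutive items have at most `⌈n/2⌉ = (n+1)/2` elements.** [folklore] -/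
theorem card_le_of_mem_indepSets {i n : ℕ} {M : Finset ℕ} (hM : M ∈ indepSets i n) : M.card ≤ (n + 1) / 2 := by
  rcases mem_indepSets.mp hM with ⟨hM1, hM2⟩
  have hbd : ∀ t ∈ M, i + 1 ≤ t ∧ t ≤ i + n := fun t ht => by have := mem_Ioc.mp (hM1 ht); omega
  -- `t ↦ (t - i - 1) / 2` is injective on `M` (two elements with the same value would be consecutive) and lands in `range ((n+1)/2)`
  have hinj : Set.InjOn (fun t => (t - i - 1) / 2) ↑M := by
    intro s hs t ht h
    have := hbd s hs; have := hbd t ht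
    simp only at h
    by_contra hne
    rcases lt_or_gt_of_ne hne with hlt | hlt
    · have h1 : s + 1 = t := by omega
      exact hM2 s hs (h1 ▸ ht)
    · have h1 : t + 1 = s := by omega
      exact hM2 t ht (h1 ▸ hs)
  have himg : ∀ t ∈ M, (fun t => (t - i - 1) / 2) t ∈ range ((n + 1) / 2) := by
    intro t ht
    have := hbd t ht
    rw [mem_range]
    simp only
    omega
  have h := card_le_card_of_injOn _ himg hinj
  rwa [card_range] at h

/-- **slopes increase**: if `M` is the unique optimum at `θ` and `M'` the unique optimum at `θ' > θ`, `M ≠ M'`, then the slope of `M` is smaller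
than the slope of `M'`: `Σ_{t∈M} w₁ t < Σ_{t∈M'} w₁ t` (the optimum is a maximum of lines). [folklore] -/
theorem slope_lt_of_unique {i n : ℕ} {θ θ' : ℝ} (hθ : θ < θ') {M M' : Finset ℕ} (hM : M ∈ indepSets i n) (hM' : M' ∈ indepSets i n)
    (huniq : ∀ S ∈ indepSets i n, S ≠ M → ∑ t ∈ S, W w₁ w₀ t θ < ∑ t ∈ M, W w₁ w₀ t θ)
    (huniq' : ∀ S ∈ indepSets i n, S ≠ M' → ∑ t ∈ S, W w₁ w₀ t θ' < ∑ t ∈ M', W w₁ w₀ t θ') (hne : M ≠ M') :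
    ∑ t ∈ M, w₁ t < ∑ t ∈ M', w₁ t := by
  have h1 := huniq M' hM' (Ne.symm hne)
  have h2 := huniq' M hM hne
  rw [sum_W_eq, sum_W_eq] at h1 h2
  nlinarith

/-- **along a chain of unique optima the slopes are strictly increasing.** [folklore] -/
theorem chain_slopes_strictMono {i n N : ℕ} (θs : Fin (N + 1) → ℝ) (hθ : StrictMono θs) (Ms : Fin (N + 1) → Finset ℕ)
    (hmem : ∀ k, Ms k ∈ indepSets i n)
    (huniq : ∀ k, ∀ S ∈ indepSets i n, S ≠ Ms k → ∑ t ∈ S, W w₁ w₀ t (θs k) < ∑ t ∈ Ms k, W w₁ w₀ t (θs k))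
    (hch : ∀ e : Fin N, Ms e.castSucc ≠ Ms e.succ) :
    StrictMono (fun k => ∑ t ∈ Ms k, w₁ t) := by
  rw [Fin.strictMono_iff_lt_succ]
  intro e
  exact slope_lt_of_unique w₁ w₀ (hθ (Fin.castSucc_lt_succ)) (hmem _) (hmem _) (huniq _) (huniq _) (hch e)

/-- a strictly increasing integer-valued sequence on `Fin (N+1)` spans at least `N`. -/
theorem le_sub_of_strictMono_int {N : ℕ} (f : Fin (N + 1) → ℤ) (hf : StrictMono f) : f 0 + N ≤ f (Fin.last N) := by
  have key : ∀ k : ℕ, (hk : k ≤ N) → f 0 + k ≤ f ⟨k, Nat.lt_succ_of_le hk⟩ := by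
    intro k
    induction k with
    | zero => intro _; simp
    | succ k ih =>
      intro hk
      have h1 := ih (by omega)
      have h2 : f ⟨k, by omega⟩ < f ⟨k + 1, by omega⟩ := hf (Fin.mk_lt_mk.mpr (Nat.lt_succ_self k))
      push_cast
      omega
  have := key N le_rfl
  exact this

/-- **UNIFORM SLOPES (uniform field sweep): at most `⌈n/2⌉` steps.**  If every item has the same slope `c`, a chain of unique optima with
consecutive sets distinct has `N ≤ (n+1)/2` (the sizes `|M_k|` are strictly monotone and bounded by `⌈n/2⌉`). [folklore] -/
theorem chain_le_half_of_uniform_slope {i n N : ℕ} {c : ℝ} (hc : ∀ t, w₁ t = c) (θs : Fin (N + 1) → ℝ) (hθ : StrictMono θs)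
    (Ms : Fin (N + 1) → Finset ℕ) (hmem : ∀ k, Ms k ∈ indepSets i n)
    (huniq : ∀ k, ∀ S ∈ indepSets i n, S ≠ Ms k → ∑ t ∈ S, W w₁ w₀ t (θs k) < ∑ t ∈ Ms k, W w₁ w₀ t (θs k))
    (hch : ∀ e : Fin N, Ms e.castSucc ≠ Ms e.succ) : N ≤ (n + 1) / 2 := by
  have hsl := chain_slopes_strictMono w₁ w₀ θs hθ Ms hmem huniq hch
  have hslope : ∀ k, ∑ t ∈ Ms k, w₁ t = c * (Ms k).card := by
    intro k
    rw [Finset.sum_congr rfl (fun t _ => hc t), sum_const, nsmul_eq_mul, mul_comm]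
  rcases lt_trichotomy c 0 with hneg | hzero | hpos
  · -- sizes strictly decrease
    have hmono : StrictMono (fun k => -((Ms k).card : ℤ)) := by
      intro a b hab
      have h := hsl hab
      simp only [hslope] at h
      have : ((Ms b).card : ℝ) < (Ms a).card := lt_of_mul_lt_mul_of_nonpos_left h hneg.le
      have : (Ms b).card < (Ms a).card := by exact_mod_cast this
      show -((Ms a).card : ℤ) < -((Ms b).card : ℤ)
      rw [neg_lt_neg_iff]
      exact_mod_cast this
    have h : -((Ms 0).card : ℤ) + N ≤ -((Ms (Fin.last N)).card : ℤ) := le_sub_of_strictMono_int (fun k => -((Ms k).card : ℤ)) hmono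
    have h0 := card_le_of_mem_indepSets (hmem 0)
    have : ((Ms 0).card : ℤ) ≤ (((n + 1) / 2 : ℕ) : ℤ) := by exact_mod_cast h0
    omega
  · -- all weights constant in `θ`: no change at all
    rcases Nat.eq_zero_or_pos N with hN | hN
    · omega
    · exfalso
      have hlt : (0 : Fin (N + 1)) < Fin.last N := by
        rw [Fin.lt_def, Fin.val_zero, Fin.val_last]; exact hN
      have h := hsl hlt
      simp only [hslope, hzero, zero_mul, lt_irrefl] at h
  · -- sizes strictly increase
    have hmono : StrictMono (fun k => ((Ms k).card : ℤ)) := by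
      intro a b hab
      have h := hsl hab
      simp only [hslope] at h
      have : ((Ms a).card : ℝ) < (Ms b).card := lt_of_mul_lt_mul_left h hpos.le
      show ((Ms a).card : ℤ) < (Ms b).card
      exact_mod_cast this
    have h : ((Ms 0).card : ℤ) + N ≤ ((Ms (Fin.last N)).card : ℤ) := le_sub_of_strictMono_int (fun k => ((Ms k).card : ℤ)) hmono
    have hN' := card_le_of_mem_indepSets (hmem (Fin.last N))
    have : ((Ms (Fin.last N)).card : ℤ) ≤ (((n + 1) / 2 : ℕ) : ℤ) := by exact_mod_cast hN'
    omega

/-- **INTEGER SLOPES of size at most `V`: at most `2 · ⌈n/2⌉ · V` steps** (the slopes `Σ_{t∈M} w₁ t` are strictly increasing integers of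
absolute value `≤ ⌈n/2⌉·V`). [folklore] -/
theorem chain_le_of_int_slopes {i n N V : ℕ} (z : ℕ → ℤ) (hz : ∀ t, w₁ t = z t) (hV : ∀ t, |z t| ≤ V) (θs : Fin (N + 1) → ℝ)
    (hθ : StrictMono θs) (Ms : Fin (N + 1) → Finset ℕ) (hmem : ∀ k, Ms k ∈ indepSets i n)
    (huniq : ∀ k, ∀ S ∈ indepSets i n, S ≠ Ms k → ∑ t ∈ S, W w₁ w₀ t (θs k) < ∑ t ∈ Ms k, W w₁ w₀ t (θs k))
    (hch : ∀ e : Fin N, Ms e.castSucc ≠ Ms e.succ) : N ≤ 2 * ((n + 1) / 2) * V := by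
  have hsl := chain_slopes_strictMono w₁ w₀ θs hθ Ms hmem huniq hch
  have hslope : ∀ k, ∑ t ∈ Ms k, w₁ t = ((∑ t ∈ Ms k, z t : ℤ) : ℝ) := by
    intro k; push_cast; exact Finset.sum_congr rfl (fun t _ => hz t)
  have hmono : StrictMono (fun k => ∑ t ∈ Ms k, z t) := by
    intro a b hab
    have h := hsl hab
    simp only [hslope] at h
    show ∑ t ∈ Ms a, z t < ∑ t ∈ Ms b, z t
    exact_mod_cast h
  have hbound : ∀ k, |∑ t ∈ Ms k, z t| ≤ (((n + 1) / 2 : ℕ) : ℤ) * V := by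
    intro k
    refine (abs_sum_le_sum_abs _ _).trans ?_
    calc ∑ t ∈ Ms k, |z t| ≤ ∑ _t ∈ Ms k, (V : ℤ) := sum_le_sum fun t _ => hV t
      _ = (Ms k).card * (V : ℤ) := by rw [sum_const, nsmul_eq_mul]
      _ ≤ (((n + 1) / 2 : ℕ) : ℤ) * V := by
        have := card_le_of_mem_indepSets (hmem k)
        exact mul_le_mul_of_nonneg_right (by exact_mod_cast this) (by positivity)
  have h : (∑ t ∈ Ms 0, z t) + N ≤ ∑ t ∈ Ms (Fin.last N), z t := le_sub_of_strictMono_int (fun k => ∑ t ∈ Ms k, z t) hmono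
  have h0 := hbound 0
  have hN := hbound (Fin.last N)
  rw [abs_le] at h0 hN
  have hz : (N : ℤ) ≤ 2 * (((n + 1) / 2 : ℕ) : ℤ) * (V : ℤ) := by linarith [h0.1, hN.2]
  exact_mod_cast hz

end

end StaticPathFold

end Summit.ValiantsHypothesis.ValiantsHypothesis.Theorems.KPlusLogSqLaw
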